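import Mathlib
import Summits.ValiantsHypothesis.ValiantsHypothesis.Theorems.NewtonUnitEquationsNewtonTauWeakCornerDefs
import Summits.ValiantsHypothesis.ValiantsHypothesis.Theorems.NewtonUnitEquationsNewtonTauWeakCornerWords

/-!
# `NewtonTauWeak` (stmt-ValiantsHypothesis-5904), stub `fixedKCoincidence_t2_K3`: truncated quotients of
# univariate factors alive at the corner

Support file (siege k16).  For univariate `A, B ∈ ℂ[s]` with `A(0) = B(0) = 1` the TRUNCATED QUOTIENT is the
polynomial `PowerSeries.trunc T (A · B⁻¹)` (inlined).  Main results: it is alive at the corner with degree `< T`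
(`quo_coeff_zero`, `quo_natDegree_lt`); `A · trunc_T(B⁻¹)` agrees with it below `s^T` (`quo_coeff_low`,
`inv_coeff_low`); its corner ORDER is the order of `A - B`, with the same leading coefficient
(`k16_isOrder_quo_iff`, `quo_coeff_order`); and the "ultrametric" side computation used to exclude the doubly
degenerate case of the dead-corner lemma (`quo_coeff_vanish_of_agree`: if `A/B` and `C/B` agree to order `k`
inclusive then `C/A ≡ 1 (mod s^{k+1})`). [folklore]
-/

set_option linter.dupNamespace false

noncomputable section

open scoped BigOperators Polynomial

namespace Summit.ValiantsHypothesis.ValiantsHypothesis.Theorems.NewtonTauWeakFixedK3k16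

open Summit.ValiantsHypothesis.ValiantsHypothesis.Theorems.NewtonTauWeakCorner
  (IsOrder IsOrder.unique IsOrder.le_natDegree)

/-! ## Orders of univariate polynomials without constant term -/

/-- A nonzero polynomial without constant term has its trailing degree as order. [folklore] -/
theorem isOrder_natTrailingDegree {R : ℂ[X]} (hR : R ≠ 0) (hR0 : R.coeff 0 = 0) :
    IsOrder R R.natTrailingDegree := by
  refine ⟨?_, Polynomial.trailingCoeff_nonzero_iff_nonzero.mpr hR, fun j _ hj =>
    Polynomial.coeff_eq_zero_of_lt_natTrailingDegree hj⟩
  by_contra h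
  have h0 : R.natTrailingDegree = 0 := by omega
  have := Polynomial.trailingCoeff_nonzero_iff_nonzero.mpr hR
  rw [Polynomial.trailingCoeff, h0] at this
  exact this hR0

/-- An order is the trailing degree. [folklore] -/
theorem isOrder_eq_natTrailingDegree {R : ℂ[X]} {k : ℕ} (hk : IsOrder R k) (hR0 : R.coeff 0 = 0) :
    k = R.natTrailingDegree := by
  have hR : R ≠ 0 := fun h => hk.2.1 (by rw [h, Polynomial.coeff_zero])
  exact hk.unique (isOrder_natTrailingDegree hR hR0)

/-! ## Power-series side -/

/-- Constant coefficient of the coercion of a polynomial. [folklore] -/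
theorem constantCoeff_coe (A : ℂ[X]) : PowerSeries.constantCoeff (A : PowerSeries ℂ) = A.coeff 0 := by
  rw [← PowerSeries.coeff_zero_eq_constantCoeff_apply, Polynomial.coeff_coe]

/-- Constant coefficient of a quotient of polynomials alive at the corner. [folklore] -/
theorem constantCoeff_quo (A B : ℂ[X]) (hA : A.coeff 0 = 1) (hB : B.coeff 0 = 1) :
    PowerSeries.constantCoeff ((A : PowerSeries ℂ) * (B : PowerSeries ℂ)⁻¹) = 1 := by
  rw [map_mul, PowerSeries.constantCoeff_inv, constantCoeff_coe, constantCoeff_coe, hA, hB]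
  norm_num

/-- `A · B⁻¹ - 1 = (A - B) · B⁻¹` for `B` alive at the corner. [folklore] -/
theorem quo_sub_one (A B : ℂ[X]) (hB : B.coeff 0 = 1) :
    (A : PowerSeries ℂ) * (B : PowerSeries ℂ)⁻¹ - 1 =
      ((A - B : ℂ[X]) : PowerSeries ℂ) * (B : PowerSeries ℂ)⁻¹ := by
  have hB' : PowerSeries.constantCoeff (B : PowerSeries ℂ) ≠ 0 := by
    rw [constantCoeff_coe, hB]; exact one_ne_zero
  rw [Polynomial.coe_sub, sub_mul, PowerSeries.mul_inv_cancel _ hB']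

/-- Low coefficients of `(A - B) · B⁻¹` when `A - B` has order `k`: zero below `k`, `[s^k](A-B)` at `k`.
[folklore] -/
theorem coeff_sub_mul_inv (A B : ℂ[X]) (hB : B.coeff 0 = 1) {k : ℕ}
    (hlow : ∀ j, j < k → (A - B).coeff j = 0) :
    (∀ j, j < k → PowerSeries.coeff j (((A - B : ℂ[X]) : PowerSeries ℂ) * (B : PowerSeries ℂ)⁻¹) = 0) ∧
      PowerSeries.coeff k (((A - B : ℂ[X]) : PowerSeries ℂ) * (B : PowerSeries ℂ)⁻¹) = (A - B).coeff k := by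
  have hdvd : (PowerSeries.X : PowerSeries ℂ) ^ k ∣ ((A - B : ℂ[X]) : PowerSeries ℂ) := by
    rw [PowerSeries.X_pow_dvd_iff]
    intro m hm
    rw [Polynomial.coeff_coe]
    exact hlow m hm
  constructor
  · have hdvd' : (PowerSeries.X : PowerSeries ℂ) ^ k ∣
        ((A - B : ℂ[X]) : PowerSeries ℂ) * (B : PowerSeries ℂ)⁻¹ := Dvd.dvd.mul_right hdvd _
    rw [PowerSeries.X_pow_dvd_iff] at hdvd'
    exact hdvd'
  · rw [PowerSeries.coeff_mul, Finset.Nat.sum_antidiagonal_eq_sum_range_succ_mk, Finset.sum_range_succ]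
    rw [Finset.sum_eq_zero]
    · simp only [Nat.sub_self, zero_add, PowerSeries.coeff_zero_eq_constantCoeff_apply,
        PowerSeries.constantCoeff_inv, constantCoeff_coe, hB, inv_one, mul_one, Polynomial.coeff_coe]
    · intro i hi
      rw [Polynomial.coeff_coe, hlow i (Finset.mem_range.mp hi), zero_mul]

/-! ## The truncated quotient -/

/-- The truncated quotient is alive at the corner. [folklore] -/
theorem quo_coeff_zero (A B : ℂ[X]) (hA : A.coeff 0 = 1) (hB : B.coeff 0 = 1) {T : ℕ} (hT : 1 ≤ T) :
    (PowerSeries.trunc T ((A : PowerSeries ℂ) * (B : PowerSeries ℂ)⁻¹)).coeff 0 = 1 := by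
  rw [PowerSeries.coeff_trunc, if_pos (by omega), PowerSeries.coeff_zero_eq_constantCoeff_apply,
    constantCoeff_quo A B hA hB]

/-- The truncated inverse is alive at the corner. [folklore] -/
theorem truncInv_coeff_zero (B : ℂ[X]) (hB : B.coeff 0 = 1) {T : ℕ} (hT : 1 ≤ T) :
    (PowerSeries.trunc T ((B : PowerSeries ℂ)⁻¹)).coeff 0 = 1 := by
  rw [PowerSeries.coeff_trunc, if_pos (by omega), PowerSeries.coeff_zero_eq_constantCoeff_apply,
    PowerSeries.constantCoeff_inv, constantCoeff_coe, hB, inv_one]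

/-- Truncations have degree `< T`. [folklore] -/
theorem quo_natDegree_lt (φ : PowerSeries ℂ) {T : ℕ} (hT : 1 ≤ T) : (PowerSeries.trunc T φ).natDegree < T := by
  obtain ⟨n, rfl⟩ : ∃ n, T = n + 1 := ⟨T - 1, by omega⟩
  exact PowerSeries.natDegree_trunc_lt φ n

/-- `A · trunc_T(B⁻¹)` agrees with the truncated quotient below `s^T`. [folklore] -/
theorem quo_coeff_low (A B : ℂ[X]) {T : ℕ} (hAT : A.natDegree < T) :
    ∀ m, m < T → (A * PowerSeries.trunc T ((B : PowerSeries ℂ)⁻¹)).coeff m =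
      (PowerSeries.trunc T ((A : PowerSeries ℂ) * (B : PowerSeries ℂ)⁻¹)).coeff m := by
  intro m hm
  have h1 : PowerSeries.coeff m ((A : PowerSeries ℂ) * (B : PowerSeries ℂ)⁻¹) =
      PowerSeries.coeff m ((A : PowerSeries ℂ) *
        ((PowerSeries.trunc T ((B : PowerSeries ℂ)⁻¹) : ℂ[X]) : PowerSeries ℂ)) := by
    rw [PowerSeries.coeff_mul_eq_coeff_trunc_mul_trunc₂ (A : PowerSeries ℂ) ((B : PowerSeries ℂ)⁻¹) hm hm,
      PowerSeries.trunc_coe_eq_self hAT]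
  rw [PowerSeries.coeff_trunc, if_pos hm, ← Polynomial.coeff_coe, Polynomial.coe_mul, h1]

/-- `B · trunc_T(B⁻¹) ≡ 1` below `s^T`. [folklore] -/
theorem inv_coeff_low (B : ℂ[X]) (hB : B.coeff 0 = 1) {T : ℕ} (hBT : B.natDegree < T) :
    ∀ m, m < T → (B * PowerSeries.trunc T ((B : PowerSeries ℂ)⁻¹)).coeff m = (1 : ℂ[X]).coeff m := by
  intro m hm
  have hB' : PowerSeries.constantCoeff (B : PowerSeries ℂ) ≠ 0 := by
    rw [constantCoeff_coe, hB]; exact one_ne_zero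
  rw [quo_coeff_low B B hBT m hm, PowerSeries.coeff_trunc, if_pos hm, PowerSeries.mul_inv_cancel _ hB',
    ← Polynomial.coeff_coe, Polynomial.coe_one]

/-- Order and leading coefficient transfer from `A - B` to the truncated quotient. [folklore] -/
theorem quo_coeff_order (A B : ℂ[X]) (hA : A.coeff 0 = 1) (hB : B.coeff 0 = 1) {T k : ℕ}
    (hk : IsOrder (A - B) k) (hkT : k < T) :
    IsOrder (PowerSeries.trunc T ((A : PowerSeries ℂ) * (B : PowerSeries ℂ)⁻¹)) k ∧
      (PowerSeries.trunc T ((A : PowerSeries ℂ) * (B : PowerSeries ℂ)⁻¹)).coeff k = (A - B).coeff k := by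
  have hlow : ∀ j, j < k → (A - B).coeff j = 0 := by
    intro j hj
    rcases Nat.eq_zero_or_pos j with rfl | hj1
    · rw [Polynomial.coeff_sub, hA, hB, sub_self]
    · exact hk.2.2 j hj1 hj
  obtain ⟨hz, hkc⟩ := coeff_sub_mul_inv A B hB hlow
  -- coefficients of the quotient in positive degree `j ≤ k`
  have hq : ∀ j, 1 ≤ j → j ≤ k →
      PowerSeries.coeff j ((A : PowerSeries ℂ) * (B : PowerSeries ℂ)⁻¹) =
        PowerSeries.coeff j (((A - B : ℂ[X]) : PowerSeries ℂ) * (B : PowerSeries ℂ)⁻¹) := by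
    intro j hj1 _
    have h := congrArg (PowerSeries.coeff j) (quo_sub_one A B hB)
    rw [map_sub, PowerSeries.coeff_one, if_neg (by omega), sub_zero] at h
    exact h
  have hcoeffk : (PowerSeries.trunc T ((A : PowerSeries ℂ) * (B : PowerSeries ℂ)⁻¹)).coeff k =
      (A - B).coeff k := by
    rw [PowerSeries.coeff_trunc, if_pos hkT, hq k hk.1 le_rfl, hkc]
  refine ⟨⟨hk.1, by rw [hcoeffk]; exact hk.2.1, fun j hj1 hjk => ?_⟩, hcoeffk⟩
  rw [PowerSeries.coeff_trunc, if_pos (by omega), hq j hj1 hjk.le, hz j hjk]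

/-- **Orders of truncated quotients** are the orders of differences (both degrees `< T`). [folklore] -/
theorem k16_isOrder_quo_iff (A B : ℂ[X]) (hA : A.coeff 0 = 1) (hB : B.coeff 0 = 1) {T : ℕ}
    (hAT : A.natDegree < T) (hBT : B.natDegree < T) (k : ℕ) :
    IsOrder (PowerSeries.trunc T ((A : PowerSeries ℂ) * (B : PowerSeries ℂ)⁻¹)) k ↔ IsOrder (A - B) k := by
  constructor
  · intro hq
    have hAB : A - B ≠ 0 := by
      intro hAB
      have hAB' : A = B := sub_eq_zero.mp hAB
      subst hAB'
      have hB' : PowerSeries.constantCoeff (A : PowerSeries ℂ) ≠ 0 := by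
        rw [constantCoeff_coe, hA]; exact one_ne_zero
      have h := hq.2.1
      rw [PowerSeries.coeff_trunc] at h
      split_ifs at h with hkT
      · rw [PowerSeries.mul_inv_cancel _ hB', PowerSeries.coeff_one,
          if_neg (Nat.one_le_iff_ne_zero.mp hq.1)] at h
        exact h rfl
      · exact h rfl
    have h0 : (A - B).coeff 0 = 0 := by rw [Polynomial.coeff_sub, hA, hB, sub_self]
    have hord := isOrder_natTrailingDegree hAB h0
    have hlt : (A - B).natTrailingDegree < T :=
      calc (A - B).natTrailingDegree ≤ (A - B).natDegree := Polynomial.natTrailingDegree_le_natDegree _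
        _ ≤ max A.natDegree B.natDegree := Polynomial.natDegree_sub_le A B
        _ < T := max_lt hAT hBT
    have hq' := (quo_coeff_order A B hA hB hord hlt).1
    rw [hq.unique hq']
    exact hord
  · intro hk
    have hlt : k < T :=
      calc k ≤ (A - B).natDegree := hk.le_natDegree
        _ ≤ max A.natDegree B.natDegree := Polynomial.natDegree_sub_le A B
        _ < T := max_lt hAT hBT
    exact (quo_coeff_order A B hA hB hk hlt).1

/-! ## The side computation for the doubly degenerate case -/

/-- **Agreement to order `k` inclusive passes to the quotient.** If the truncated quotients `A/B` and `C/B`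
both have order `k` at the corner with the same order coefficient, then `C/A ≡ 1 (mod s^{k+1})`: the
truncated quotient `C/A` has no coefficient in degrees `1..k`. [folklore] -/
theorem quo_coeff_vanish_of_agree (A B C : ℂ[X]) (hA : A.coeff 0 = 1) (hB : B.coeff 0 = 1) (hC : C.coeff 0 = 1)
    {T k : ℕ} (hkT : k < T)
    (hU : IsOrder (PowerSeries.trunc T ((A : PowerSeries ℂ) * (B : PowerSeries ℂ)⁻¹)) k)
    (hW : IsOrder (PowerSeries.trunc T ((C : PowerSeries ℂ) * (B : PowerSeries ℂ)⁻¹)) k)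
    (heq : (PowerSeries.trunc T ((A : PowerSeries ℂ) * (B : PowerSeries ℂ)⁻¹)).coeff k =
      (PowerSeries.trunc T ((C : PowerSeries ℂ) * (B : PowerSeries ℂ)⁻¹)).coeff k) :
    ∀ m, 1 ≤ m → m ≤ k → (PowerSeries.trunc T ((C : PowerSeries ℂ) * (A : PowerSeries ℂ)⁻¹)).coeff m = 0 := by
  set u : PowerSeries ℂ := (A : PowerSeries ℂ) * (B : PowerSeries ℂ)⁻¹ with hu
  set v : PowerSeries ℂ := (C : PowerSeries ℂ) * (B : PowerSeries ℂ)⁻¹ with hv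
  have hA' : PowerSeries.constantCoeff (A : PowerSeries ℂ) ≠ 0 := by
    rw [constantCoeff_coe, hA]; exact one_ne_zero
  have hu0 : PowerSeries.constantCoeff u ≠ 0 := by
    rw [hu, constantCoeff_quo A B hA hB]; exact one_ne_zero
  -- `u` and `v` agree up to order `k`
  have hagree : ∀ j, j < k + 1 → PowerSeries.coeff j (v - u) = 0 := by
    intro j hj
    rw [map_sub, sub_eq_zero]
    rcases Nat.eq_zero_or_pos j with rfl | hj1
    · rw [PowerSeries.coeff_zero_eq_constantCoeff_apply, PowerSeries.coeff_zero_eq_constantCoeff_apply,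
        hv, hu, constantCoeff_quo C B hC hB, constantCoeff_quo A B hA hB]
    · rcases lt_or_eq_of_le (Nat.lt_succ_iff.mp hj) with hjk | rfl
      · have h1 := hU.2.2 j hj1 hjk
        have h2 := hW.2.2 j hj1 hjk
        rw [PowerSeries.coeff_trunc, if_pos (by omega)] at h1 h2
        rw [h1, h2]
      · rw [PowerSeries.coeff_trunc, if_pos hkT, PowerSeries.coeff_trunc, if_pos hkT] at heq
        exact heq.symm
  have hdvd : (PowerSeries.X : PowerSeries ℂ) ^ (k + 1) ∣ v - u := PowerSeries.X_pow_dvd_iff.mpr hagree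
  -- `C/A - 1 = (v - u) · u⁻¹`
  have hid : (C : PowerSeries ℂ) * (A : PowerSeries ℂ)⁻¹ - 1 = (v - u) * u⁻¹ := by
    have h1 : ((C : PowerSeries ℂ) * (A : PowerSeries ℂ)⁻¹ - 1) * u = v - u := by
      rw [hu, hv, sub_mul, one_mul, mul_assoc, ← mul_assoc ((A : PowerSeries ℂ)⁻¹),
        PowerSeries.inv_mul_cancel _ hA', one_mul]
    calc (C : PowerSeries ℂ) * (A : PowerSeries ℂ)⁻¹ - 1
        = ((C : PowerSeries ℂ) * (A : PowerSeries ℂ)⁻¹ - 1) * (u * u⁻¹) := by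
          rw [PowerSeries.mul_inv_cancel _ hu0, mul_one]
      _ = (v - u) * u⁻¹ := by rw [← mul_assoc, h1]
  have hdvd' : (PowerSeries.X : PowerSeries ℂ) ^ (k + 1) ∣ (C : PowerSeries ℂ) * (A : PowerSeries ℂ)⁻¹ - 1 := by
    rw [hid]; exact Dvd.dvd.mul_right hdvd _
  rw [PowerSeries.X_pow_dvd_iff] at hdvd'
  intro m hm1 hmk
  have h := hdvd' m (by omega)
  rw [map_sub, PowerSeries.coeff_one, if_neg (by omega), sub_zero] at h
  rw [PowerSeries.coeff_trunc, if_pos (by omega), h]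

end Summit.ValiantsHypothesis.ValiantsHypothesis.Theorems.NewtonTauWeakFixedK3k16

end
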